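import Summits.RiemannHypothesis.RiemannHypothesis.Theses.SpectralTrace
import Summits.RiemannHypothesis.RiemannHypothesis.Theorems.SpectralIsHpSpectrum.Negative.RefutationImpliesRH
import Summits.RiemannHypothesis.RiemannHypothesis.Theorems.WindowTraceArch.Negative.ComplexSpectrum
import Literature.NumberTheory.LFunctions.WeilMellinBounds
import Literature.NumberTheory.LFunctions.WeilArchimedeanPositivityProofs
import Literature.NumberTheory.LFunctions.SimpleZeros
import HarnessLib

/-!
# RiemannHypothesis / SpectralTrace — the crux `SpectralIsHpSpectrum` (stmt-RiemannHypothesis-0195) via the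
tilted spectral measure and Lévy uniqueness (line `translation-orbit-charfun`), DEF-FREE

Route `RiemannHypothesis/SpectralTrace`, item stmt-RiemannHypothesis-0195 (`SpectralIsHpSpectrum`, rank 5):

  `∀ ι (γ : ι → ℝ), (∀ Weil g, HasSum (i ↦ ĝ(1/2 + iγ_i)) (W g)) →
     ∀ z, {i | 1/2 + iγ_i = z}.encard = 𝟙_{non-trivial zeros}(z) · analyticOrderNatAt ζ z`.

Proof (the crux line `Cruxes/SpectralIsHpSpectrum/Lines/translation-orbit-charfun.lean`, gen 2, with both of its
stubs discharged; restated here WITHOUT definitions so that it is a pure-proof file over landed modules):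

1. For a real family `γ` reproducing a functional `L` on every Weil test and a Weil test `k`, the tilted spectral
   measure `ν = Σ_i ‖k̂(1/2+iγ_i)‖² δ_{γ_i}` (a `Measure.sum` of weighted Diracs over the arbitrary index type) is
   FINITE: its mass is `Re L(k ⋆ k̃)` because `(k ⋆ k̃)^(1/2+iu) = ‖k̂(1/2+iu)‖²`
   (`weilMellin_weilConv_weilReflect_half`) — `isFiniteMeasure_tilt`.
2. Its characteristic function is the translation orbit of ONE test: `charFun ν t = L(τ_t (k ⋆ k̃))`, since on the
   critical line translation is the unimodular phase `e^{iut}` (`weilMellin_weilTranslate`) — `charFun_tilt`.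
3. Two real families reproducing the SAME `L` therefore have equal finite tilted measures (`Measure.ext_of_charFun`),
   hence equal atoms `‖k̂(1/2+ix)‖² · #{i | γ_i = x}`; a bump with `k̂(1/2+ix) ≠ 0`
   (`exists_isWeilTest_re_weilMellin_pos`) cancels the weight — `encard_fibre_eq_of_spectra`.
4. The hypothesis proves RH (`riemannHypothesis_of_trace`, landed Negative lemma); under RH the zeta ordinates repeated
   with multiplicity reproduce `W` (`hasSum_weilMellin_zeros`, `eq_half_add_of_riemannHypothesis`) and their fibre count
   IS the right-hand side (`encard_zetaOrdinates_fibre`); off the critical line both sides vanish.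

References: Y. Katznelson, An Introduction to Harmonic Analysis (3rd ed. 2004) VI.2.2 Cor. (uniqueness of
Fourier–Stieltjes transforms); E. Bombieri, Rend. Lincei (9) 11 (2000) §2.
-/

noncomputable section

-- `<Summit> = <Problem>` duplicates a namespace component; the tree's lakefile sets `weak.linter.dupNamespace = false`
-- (this line only silences standalone checks and may be dropped when landing).
set_option linter.dupNamespace false

open Complex Set MeasureTheory Filter
open scoped Real Topology ENNReal

namespace Summit.RiemannHypothesis.RiemannHypothesis.Theorems.SpectralIsHpSpectrumViaTilt

open Literature.NumberTheory.LFunctions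
open Summit.RiemannHypothesis.RiemannHypothesis.Theorems.WindowTraceArch.Negative
open Summit.RiemannHypothesis.RiemannHypothesis.Theorems.SpectralIsHpSpectrum.Negative (riemannHypothesis_of_trace)

/-! ## 1. The tilted spectral measure: atoms, mass, finiteness -/

/-- Atom read-out of the tilted spectral measure over an ARBITRARY index type:
`ν{x} = ofReal ‖k̂(1/2+ix)‖² · #{i | γ_i = x}` in `ℝ≥0∞` (count as `encard`). [folklore] -/
theorem tilt_apply_singleton {ι : Type*} (γ : ι → ℝ) (k : ℝ → ℂ) (x : ℝ) :
    (Measure.sum fun i => ENNReal.ofReal (‖weilMellin k (1 / 2 + (γ i : ℂ) * I)‖ ^ 2) • Measure.dirac (γ i)) {x} =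
      ENNReal.ofReal (‖weilMellin k (1 / 2 + (x : ℂ) * I)‖ ^ 2) * {i | γ i = x}.encard := by
  rw [Measure.sum_apply _ (measurableSet_singleton x)]
  have h : ∀ i, (ENNReal.ofReal (‖weilMellin k (1 / 2 + (γ i : ℂ) * I)‖ ^ 2) • Measure.dirac (γ i)) {x} =
      ({i | γ i = x} : Set ι).indicator (fun _ => ENNReal.ofReal (‖weilMellin k (1 / 2 + (x : ℂ) * I)‖ ^ 2)) i := by
    intro i
    rw [Measure.smul_apply, smul_eq_mul, Measure.dirac_apply' _ (measurableSet_singleton x)]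
    by_cases hi : γ i = x
    · rw [Set.indicator_of_mem (show i ∈ {i | γ i = x} from hi),
        Set.indicator_of_mem (show γ i ∈ ({x} : Set ℝ) from hi), hi]
      simp
    · rw [Set.indicator_of_notMem (show i ∉ {i | γ i = x} from hi),
        Set.indicator_of_notMem (show γ i ∉ ({x} : Set ℝ) from hi)]
      simp
  simp_rw [h]
  rw [← tsum_subtype {i | γ i = x} (fun _ => ENNReal.ofReal (‖weilMellin k (1 / 2 + (x : ℂ) * I)‖ ^ 2)),
    ENNReal.tsum_set_const, mul_comm]

/-- Mass identity: `Σ_i ‖k̂(1/2+iγ_i)‖² = Re L(k ⋆ k̃)` as a `HasSum` of non-negative reals, for a real family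
reproducing `L` on Weil tests (the hypothesis at the Weil test `k ⋆ k̃`, real parts). [folklore] -/
theorem hasSum_norm_sq_of_spectrum {ι : Type*} {γ : ι → ℝ} {L : (ℝ → ℂ) → ℂ}
    (hγ : ∀ g : ℝ → ℂ, IsWeilTest g → HasSum (fun i => weilMellin g (1 / 2 + (γ i : ℂ) * I)) (L g))
    {k : ℝ → ℂ} (hk : IsWeilTest k) :
    HasSum (fun i => ‖weilMellin k (1 / 2 + (γ i : ℂ) * I)‖ ^ 2) (L (weilConv k (weilReflect k))).re := by
  have hre := ((Complex.hasSum_iff _ _).mp (hγ _ (hk.weilConv hk.weilReflect))).1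
  convert hre using 1
  funext i
  rw [weilMellin_weilConv_weilReflect_half hk (γ i), Complex.ofReal_re]

/-- **Finiteness of the tilted spectral measure** of a real family reproducing some functional on Weil tests.
[folklore] -/
theorem isFiniteMeasure_tilt {ι : Type*} {γ : ι → ℝ} {L : (ℝ → ℂ) → ℂ}
    (hγ : ∀ g : ℝ → ℂ, IsWeilTest g → HasSum (fun i => weilMellin g (1 / 2 + (γ i : ℂ) * I)) (L g))
    {k : ℝ → ℂ} (hk : IsWeilTest k) :
    IsFiniteMeasure
      (Measure.sum fun i => ENNReal.ofReal (‖weilMellin k (1 / 2 + (γ i : ℂ) * I)‖ ^ 2) • Measure.dirac (γ i)) := by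
  refine ⟨?_⟩
  rw [Measure.sum_apply _ MeasurableSet.univ]
  simp only [Measure.smul_apply, measure_univ, smul_eq_mul, mul_one]
  rw [← ENNReal.ofReal_tsum_of_nonneg (fun i => by positivity) (hasSum_norm_sq_of_spectrum hγ hk).summable]
  exact ENNReal.ofReal_lt_top

/-! ## 2. The lever: the translation orbit of one test is the characteristic function -/

/-- **`charFun ν t = L(τ_t (k ⋆ k̃))`**: the integrand `e^{itx}` is unimodular and continuous, hence integrable
against the finite `Measure.sum`; `integral_sum_measure` (no countability), `integral_dirac`; on the other side the
hypothesis at the Weil test `τ_t (k ⋆ k̃)` with `(τ_t h)^(1/2+iu) = e^{iut} ĥ(1/2+iu)`. [folklore] -/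
theorem charFun_tilt {ι : Type*} {γ : ι → ℝ} {L : (ℝ → ℂ) → ℂ}
    (hγ : ∀ g : ℝ → ℂ, IsWeilTest g → HasSum (fun i => weilMellin g (1 / 2 + (γ i : ℂ) * I)) (L g))
    {k : ℝ → ℂ} (hk : IsWeilTest k) (t : ℝ) :
    charFun (Measure.sum fun i =>
        ENNReal.ofReal (‖weilMellin k (1 / 2 + (γ i : ℂ) * I)‖ ^ 2) • Measure.dirac (γ i)) t =
      L (weilTranslate (weilConv k (weilReflect k)) t) := by
  haveI := isFiniteMeasure_tilt hγ hk
  rw [← (hγ _ ((hk.weilConv hk.weilReflect).weilTranslate t)).tsum_eq, charFun_apply_real]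
  have hint : Integrable (fun x : ℝ => cexp (t * x * I)) (Measure.sum fun i =>
      ENNReal.ofReal (‖weilMellin k (1 / 2 + (γ i : ℂ) * I)‖ ^ 2) • Measure.dirac (γ i)) := by
    refine (integrable_const (1 : ℝ)).mono' ?_ ?_
    · exact (by fun_prop : Continuous fun x : ℝ => cexp (t * x * I)).aestronglyMeasurable
    · filter_upwards with x
      rw [Complex.norm_exp]
      simp
  rw [integral_sum_measure hint]
  congr 1
  funext i
  rw [integral_smul_measure, integral_dirac, ENNReal.toReal_ofReal (by positivity), weilMellin_weilTranslate,
    weilMellin_weilConv_weilReflect_half hk, Complex.real_smul]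
  push_cast
  ring_nf

/-! ## 3. Lévy uniqueness: two real families reproducing the same functional have equal multiplicities -/

/-- **Rigidity of real spectra (W-free).** [Katznelson2004, VI.2.2 Cor.] -/
theorem encard_fibre_eq_of_spectra {ι ι' : Type*} {γ : ι → ℝ} {γ' : ι' → ℝ} {L : (ℝ → ℂ) → ℂ}
    (hγ : ∀ g : ℝ → ℂ, IsWeilTest g → HasSum (fun i => weilMellin g (1 / 2 + (γ i : ℂ) * I)) (L g))
    (hγ' : ∀ g : ℝ → ℂ, IsWeilTest g → HasSum (fun j => weilMellin g (1 / 2 + (γ' j : ℂ) * I)) (L g))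
    (x : ℝ) : {i | γ i = x}.encard = {j | γ' j = x}.encard := by
  obtain ⟨k, hk, hpos⟩ := exists_isWeilTest_re_weilMellin_pos x
  have hw : 0 < ‖weilMellin k (1 / 2 + (x : ℂ) * I)‖ ^ 2 := by
    have h1 := hpos (1 / 2)
    have h2 : ((1 / 2 : ℝ) : ℂ) + x * I = 1 / 2 + x * I := by push_cast; ring
    rw [h2] at h1
    have hne : weilMellin k (1 / 2 + x * I) ≠ 0 := by
      intro h0
      rw [h0] at h1
      simp at h1
    exact pow_pos (norm_pos_iff.mpr hne) 2
  haveI := isFiniteMeasure_tilt hγ hk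
  haveI := isFiniteMeasure_tilt hγ' hk
  have hcf : charFun (Measure.sum fun i =>
        ENNReal.ofReal (‖weilMellin k (1 / 2 + (γ i : ℂ) * I)‖ ^ 2) • Measure.dirac (γ i)) =
      charFun (Measure.sum fun j =>
        ENNReal.ofReal (‖weilMellin k (1 / 2 + (γ' j : ℂ) * I)‖ ^ 2) • Measure.dirac (γ' j)) := by
    funext t
    rw [charFun_tilt hγ hk t, charFun_tilt hγ' hk t]
  have hx : (Measure.sum fun i =>
        ENNReal.ofReal (‖weilMellin k (1 / 2 + (γ i : ℂ) * I)‖ ^ 2) • Measure.dirac (γ i)) {x} =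
      (Measure.sum fun j =>
        ENNReal.ofReal (‖weilMellin k (1 / 2 + (γ' j : ℂ) * I)‖ ^ 2) • Measure.dirac (γ' j)) {x} := by
    rw [Measure.ext_of_charFun hcf]
  rw [tilt_apply_singleton γ k x, tilt_apply_singleton γ' k x] at hx
  exact ENat.toENNReal_inj.mp
    ((ENNReal.mul_right_inj (ENNReal.ofReal_pos.mpr hw).ne' ENNReal.ofReal_ne_top).mp hx)

/-! ## 4. Calibration against the zeta ordinates under RH, and the crux -/

/-- Under RH the non-trivial zeros are on the critical line. [folklore] -/
theorem re_eq_half_of_mem_nontrivialZeros (hRH : _root_.RiemannHypothesis) {z : ℂ}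
    (hz : z ∈ ZetaZeros.riemannZetaNontrivialZeros) : z.re = 1 / 2 := by
  refine hRH z (ZetaZeros.riemannZetaNontrivialZeros.zeta_eq_zero hz) ?_
    (ZetaZeros.riemannZetaNontrivialZeros.ne_one hz)
  rintro ⟨n, hn⟩
  have h0 := ZetaZeros.riemannZetaNontrivialZeros.re_pos hz
  rw [hn] at h0
  simp at h0
  linarith [n.cast_nonneg (α := ℝ)]

/-- `m(s) = analyticOrderNatAt ζ s` for `s ≠ 1` (the explicit formula's multiplicity is the crux's). [folklore] -/
theorem riemannZetaZeroOrder_eq_analyticOrderNatAt' {s : ℂ} (hs : s ≠ 1) :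
    riemannZetaZeroOrder s = (analyticOrderNatAt riemannZeta s : ℤ) := by
  have ha : AnalyticAt ℂ riemannZeta s := analyticOn_riemannZeta s hs
  obtain ⟨n, hn⟩ := ENat.ne_top_iff_exists.mp (analyticOrderAt_riemannZeta_ne_top hs)
  rw [riemannZetaZeroOrder, ha.meromorphicOrderAt_eq, ← hn, ENat.map_coe, WithTop.untop₀_coe,
    analyticOrderNatAt, ← hn, ENat.toNat_coe]

/-- **Fibre count of the zeta ordinates IS the crux's right-hand side**, in `ℕ∞`, under RH. [folklore] -/
theorem encard_zetaOrdinates_fibre (hRH : _root_.RiemannHypothesis) (τ : ℝ) :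
    {p : (Σ ρ : ZetaZeros.riemannZetaNontrivialZeros, Fin (riemannZetaZeroOrder (ρ : ℂ)).toNat) |
        (p.1 : ℂ).im = τ}.encard =
      ZetaZeros.riemannZetaNontrivialZeros.indicator
        (fun w => (analyticOrderNatAt riemannZeta w : ℕ∞)) (1 / 2 + τ * I) := by
  set s : ℂ := 1 / 2 + τ * I with hs_def
  have hs1 : s ≠ 1 := by
    intro h
    have := congrArg Complex.re h
    norm_num [hs_def] at this
  by_cases hz : s ∈ ZetaZeros.riemannZetaNontrivialZeros
  · have hset : {p : (Σ ρ : ZetaZeros.riemannZetaNontrivialZeros,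
        Fin (riemannZetaZeroOrder (ρ : ℂ)).toNat) | (p.1 : ℂ).im = τ} =
        Set.range (Sigma.mk (β := fun ρ : ZetaZeros.riemannZetaNontrivialZeros =>
          Fin (riemannZetaZeroOrder (ρ : ℂ)).toNat) ⟨s, hz⟩) := by
      ext p
      simp only [Set.mem_setOf_eq, Set.mem_range]
      constructor
      · intro hp
        obtain ⟨ρ, c⟩ := p
        have hρ : ρ = ⟨s, hz⟩ := by
          apply Subtype.ext
          have h1 := eq_half_add_of_riemannHypothesis hRH ρ
          simp only at hp
          rw [← h1, hp]
        subst hρ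
        exact ⟨c, rfl⟩
      · rintro ⟨c, rfl⟩
        simp [hs_def]
    rw [hset, Set.indicator_of_mem hz, ← (Set.finite_range _).cast_ncard_eq,
      Set.ncard_range_of_injective sigma_mk_injective, Nat.card_eq_fintype_card, Fintype.card_fin]
    have h2 : (riemannZetaZeroOrder s).toNat = analyticOrderNatAt riemannZeta s := by
      rw [riemannZetaZeroOrder_eq_analyticOrderNatAt' hs1]; simp
    rw [h2]
  · have hset : {p : (Σ ρ : ZetaZeros.riemannZetaNontrivialZeros,
        Fin (riemannZetaZeroOrder (ρ : ℂ)).toNat) | (p.1 : ℂ).im = τ} = ∅ := by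
      ext p
      simp only [Set.mem_setOf_eq, Set.mem_empty_iff_false, iff_false]
      intro hp
      apply hz
      have h1 := eq_half_add_of_riemannHypothesis hRH p.1
      rw [hp] at h1
      rw [hs_def, h1]
      exact p.1.2
    rw [hset, Set.encard_empty, Set.indicator_of_notMem hz]

/-- **The crux `SpectralIsHpSpectrum` (stmt-RiemannHypothesis-0195).**  RH from the hypothesis
(`riemannHypothesis_of_trace`); off the critical line the fibre is empty and `z` is no non-trivial zero; on the line,
rigidity of real spectra (`encard_fibre_eq_of_spectra`) against the zeta ordinates (`hasSum_weilMellin_zeros`), counted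
by `encard_zetaOrdinates_fibre`. [Katznelson2004, VI.2.2 Cor.; Bombieri2000Weil, §2] -/
theorem spectralIsHpSpectrum_via_tilt :
    Summit.RiemannHypothesis.RiemannHypothesis.Theses.SpectralTrace.SpectralIsHpSpectrum := by
  intro ι γ hγ z
  have hRH : _root_.RiemannHypothesis := riemannHypothesis_of_trace hγ
  have hZ : ∀ g : ℝ → ℂ, IsWeilTest g →
      HasSum (fun p : (Σ ρ : ZetaZeros.riemannZetaNontrivialZeros, Fin (riemannZetaZeroOrder (ρ : ℂ)).toNat) =>
        weilMellin g (1 / 2 + (((p.1 : ℂ).im : ℝ) : ℂ) * I)) (weilFunctional g) := by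
    intro g hg
    simpa only [eq_half_add_of_riemannHypothesis hRH] using hasSum_weilMellin_zeros hg
  by_cases hre : z.re = 1 / 2
  · have hzeq : z = 1 / 2 + (z.im : ℝ) * I := by
      apply Complex.ext <;> simp [hre]
    have hfib : {i : ι | (1 / 2 : ℂ) + (γ i : ℂ) * I = z} = {i | γ i = z.im} := by
      ext i
      simp only [Set.mem_setOf_eq]
      constructor
      · intro h
        have := congrArg Complex.im h
        simpa using this
      · intro h
        rw [hzeq]
        simp [h]
    rw [hfib, encard_fibre_eq_of_spectra hγ hZ z.im, encard_zetaOrdinates_fibre hRH z.im, ← hzeq]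
  · have hfib : {i : ι | (1 / 2 : ℂ) + (γ i : ℂ) * I = z} = ∅ := by
      ext i
      simp only [Set.mem_setOf_eq, Set.mem_empty_iff_false, iff_false]
      intro h
      apply hre
      have := congrArg Complex.re h
      simp at this
      rw [← this]
      norm_num
    rw [hfib, Set.encard_empty,
      Set.indicator_of_notMem fun hmem => hre (re_eq_half_of_mem_nontrivialZeros hRH hmem)]

end Summit.RiemannHypothesis.RiemannHypothesis.Theorems.SpectralIsHpSpectrumViaTilt

end
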